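import Mathlib

/-!
# Stub S4 `stub_pairAlgIndependent` for crux stmt-ValiantsHypothesis-6625 (line Sketch)

Over the pairs `a < b` in `Fin n`, the products `X (b + k, a) * X (a + k, b)` of two variables of
`MvPolynomial (Fin n × Fin n) ℂ` are algebraically independent over `ℂ`: the algebra map sending the
position `(b + k, a)` to `X ⟨(a, b), _⟩`, the position `(a + k, b)` to `1` and everything else to `0`
sends the family to the variables `X e`, which are algebraically independent.
-/

open MvPolynomial

-- `Summit.ValiantsHypothesis.ValiantsHypothesis.…` is the tree's mandated single-conjunct layout.
set_option linter.dupNamespace false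

namespace Summit.ValiantsHypothesis.ValiantsHypothesis.Theorems.ElementaryWordLengthWordPerCubic

/-- S4 — **independence of the pair products**: the `n(n-1)/2` products `X(b + k, a)·X(a + k, b)`,
`a < b`, of pairwise disjoint pairs of variables are algebraically independent over `ℂ`. -/
theorem stub_pairAlgIndependent (n : ℕ) (k : Fin n) :
    AlgebraicIndependent ℂ (fun e : {e : Fin n × Fin n // e.1 < e.2} =>
      (X (e.1.2 + k, e.1.1) * X (e.1.1 + k, e.1.2) : MvPolynomial (Fin n × Fin n) ℂ)) := by
  haveI : NeZero n := NeZero.of_pos (Fin.pos k)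
  refine AlgebraicIndependent.of_comp
    (aeval fun v : Fin n × Fin n =>
      if h : v.2 < v.1 - k then
        (X ⟨(v.2, v.1 - k), h⟩ : MvPolynomial {e : Fin n × Fin n // e.1 < e.2} ℂ)
      else if v.1 - k < v.2 then 1 else 0) ?_
  convert MvPolynomial.algebraicIndependent_X {e : Fin n × Fin n // e.1 < e.2} ℂ using 1
  funext e
  obtain ⟨⟨a, b⟩, hab⟩ := e
  have hba : ¬ b < a := lt_asymm hab
  simp [hab, hba]

end Summit.ValiantsHypothesis.ValiantsHypothesis.Theorems.ElementaryWordLengthWordPerCubic
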